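import HarnessLib

/-!
# Superseded workfile

`Lines/birth_SignLaw.lean` was the BC3 birth skeleton of piece X2 under its first name `SignLaw`; the
piece was renamed `ShadowSignLaw` (2026-08-17, to keep the summit's vocabulary unambiguous — route
QuadraticWindow used "SignLaw" for its archimedean sign law).  Current file:
`Lines/birth_ShadowSignLaw.lean`.  This module intentionally declares nothing.
-/
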